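/-
COR-CM (cells pub-hodgecm / pub-hodgecm2, Hodge ladder stage 2) — TRANSPOSITION item (vi), sub-binder S2 `supply`
(hodge-director/ITEM6-SPLIT.md §(c′) (vi-2) MATCH-SPLIT ∕ §5; own-htheta g3 `Item6SupplyPinned.lean` binder (hCM)): the
CM side of the PINNED junction AT LIU'S OWN FIELD `M_μ`.  Written by the stage-1 binder seat pub-hodgecm-mc-binder-1 (gen 22,
prover-pub-hodgecm-mc-binder-1-g22-0) in its own count-neutral lane (theorems only: no definition, no instance, no named
fact, nothing asserted; nothing under `CorCM/B01/` is edited or restated).  HC_CM is NOT proved.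
-/
import Literature.NumberTheory.Automorphic.IdeleClassCharacterValueFieldCM
import Summits.HodgeConjecture.CorCM.CMSideReachOfInverseType
import HarnessLib

/-!
# (C6b*) at the Liu pin: `A_{(M_μ, Ψ̃_μ)}` reaches `A_{(F,Φ)}` — the (hCM) binder of the pinned junction is a theorem

Setting ([Liu2021] §4.1, Def. 4.3 (2), Def. 4.5 (2); cells' pinned junction `Model.faceSupply_of_thm418AsPrinted_pinned`):
`F` a Galois CM field (`F : CMField`, `[IsGalois ℚ F]`), `ι₁ : F → ℂ`, CM types `Φ, Θ` of `F` inverse through `ι₁`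
(`Θ = Φ^{*ι₁}`, item (ii)), and a conjugate symplectic automorphic character `μ = ψ : C_F →ₜ* S¹` WITH CM TYPE `Φ_μ = Θ`
(`IdeleClassGroup.HasCMType F ψ Θ`; weight-one such `μ` exist for every `Θ`: tree
`IdeleClassGroup.exists_isConjugateSymplectic_hasCMType`).  Liu's objects on the CM side are then REAL tree objects:

* `M_μ = IdeleClassGroup.muAlgValueField F ψ ⊆ ℂ` (the field generated by the values of `μ^{alg}` on `(𝔸_F^∞)^×`), a CM NUMBER
  FIELD (`IsConjugateSymplectic.numberField_muAlgValueField` ∕ `.isCMField_muAlgValueField`,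
  `Literature/NumberTheory/Automorphic/IdeleClassCharacterValueFieldCM.lean`), hence a bundled `CMField` `⟨M_μ⟩`;
* `M'_μ = K*`, the reflex field of `(F, Θ)`: in the tree `reflexField ℚ F (algValuedIn ι₁ Θ) ⊆ F` read in `ℂ` through `ι₁` IS
  `traceField Θ ⊆ M_μ` (`ComplexMultiplication.map_reflexField_algValuedIn` + `IsConjugateSymplectic.traceField_le_muAlgValueField`
  = [Liu2021] "`M_μ` … containing `M'_μ`"), which gives the INCLUSION `e_μ : K* → M_μ`, `k ↦ ι₁(k)`
  (`exists_ringHom_reflexField_muAlgValueField`; no definition is introduced — the map is produced existentially with its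
  defining property `(e k : ℂ) = ι₁ k`, which determines it);
* `Ψ̃_μ = (Θ*)^{M_μ} = inducedCMType e_μ (reflexCMType ι₁ Θ id)`, the CM type of `M_μ` induced from the reflex type — by
  [Liu2021] Def. 4.5 (2) first bullet + Def. 4.3 (2) (tree `Liu2021.LiuCMData.cmType_eq_induced_of_det45`) this is the type of
  `A_μ ⊗_{E,ι₁} ℂ` over `M_μ`, so the tree's own CM abelian variety `A_{(M_μ, Ψ̃_μ)} = (cmRealisation h₃ (cmCode ⟨M_μ⟩ Ψ̃_μ)).AV`
  is (isogenous to) Liu's `A_μ ⊗_{E,ι₁} ℂ` — the honest value of the pin `Aμ Dμ`.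

Main statement `Model.exists_liuPin_reach`: for these data, **every non-zero `u : X ⟶ A_{(M_μ, Ψ̃_μ)}` yields a non-zero
`X ⟶ A_{(F,Φ)}`** — by binder-1 gen 21's `Model.exists_hom_cmAV_ne_zero_of_reach_cmCode_reflex` (`CMSideReachOfInverseType.lean`,
Shimura §6 over Riemann) at `M := ⟨M_μ⟩`, `e := e_μ`.  So at the Liu pin the junction's (hCM) binder is DISCHARGED and only
(hReach) (the Shimura–Albanese side, C0 ∕ C6a) remains posited on the object-match line; HC_CM is NOT proved.

References: Y. Liu, *Fourier–Jacobi cycles and arithmetic relative trace formula*, Camb. J. Math. 9 (2021) = arXiv:2102.11518,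
§4.1 (TeX ll. 1922–1928), Def. 4.3 (2) (l. 1919), Def. 4.5 (2) (ll. 1944–1951); G. Shimura, *Abelian Varieties with Complex
Multiplication and Modular Functions* (1998) §6.2 Thm. 3, §8.3 Prop. 28, §18.2.
-/

noncomputable section

namespace Summit.HodgeConjecture.CorCM.Model

open CategoryTheory NumberField
open Literature.AlgebraicGeometry.Motives
open Literature.NumberTheory.ComplexMultiplication
open Literature.NumberTheory.Automorphic
open Literature.NumberTheory.Automorphic.IdeleClassGroup
open Literature.NumberTheory.Automorphic.PicardCM (cmRealisation CMAbelianVarietyRealised)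
open Literature.AlgebraicGeometry.HodgeTheory (complexBetti)
open Literature.AlgebraicGeometry.ComplexMultiplication (IsCMTypeRealisation)

/-- **`ι₁(K*) ⊆ M_μ`**: for a conjugate symplectic `μ` of CM type `Θ` on a Galois CM field `F`, the complex embedding `ι₁`
maps the reflex field `K* = reflexField ℚ F (algValuedIn ι₁ Θ) ⊆ F` of `(F, Θ)` into Liu's `M_μ` (`ι₁(K*) = traceField Θ`,
Shimura §8.3 Prop. 28, and `traceField Θ ⊆ M_μ`, [Liu2021] §4.1 "`M_μ` … containing `M'_μ`").
[cite: Liu2021, §4.1 (TeX l. 1928) and Def. 4.3 (2)] [cite: Shimura1998, §8.3 Prop. 28] -/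
theorem apply_mem_muAlgValueField_of_mem_reflexField (F : CMField) [IsGalois ℚ F] (ι₁ : F →+* ℂ) (Θ : CMType F)
    {ψ : IdeleClassGroup F →ₜ* Circle} (hψ : IsConjugateSymplectic F ψ) (hT : HasCMType F ψ Θ)
    {k : F} (hk : k ∈ reflexField ℚ F (algValuedIn ι₁ Θ.1)) : ι₁ k ∈ muAlgValueField F ψ := by
  have hmem : ι₁ k ∈ traceField Θ := by
    rw [← map_reflexField_algValuedIn (AlgHom.id ℚ F) ι₁ Θ, IntermediateField.mem_map]
    exact ⟨k, hk, rfl⟩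
  exact hψ.traceField_le_muAlgValueField hT hmem

/-- **The inclusion `e_μ : K* → M_μ`, `k ↦ ι₁(k)`** (Liu's `M'_μ ⊆ M_μ` at the tree's reflex field), produced with its defining
property. [cite: Liu2021, §4.1 (TeX l. 1928) and Def. 4.3 (2)] -/
theorem exists_ringHom_reflexField_muAlgValueField (F : CMField) [IsGalois ℚ F] (ι₁ : F →+* ℂ) (Θ : CMType F)
    {ψ : IdeleClassGroup F →ₜ* Circle} (hψ : IsConjugateSymplectic F ψ) (hT : HasCMType F ψ Θ) :
    ∃ e : reflexField ℚ F (algValuedIn ι₁ Θ.1) →+* muAlgValueField F ψ,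
      ∀ k : reflexField ℚ F (algValuedIn ι₁ Θ.1), ((e k : muAlgValueField F ψ) : ℂ) = ι₁ k :=
  ⟨(ι₁.comp (reflexField ℚ F (algValuedIn ι₁ Θ.1)).val.toRingHom).codRestrict (muAlgValueField F ψ)
      fun k => apply_mem_muAlgValueField_of_mem_reflexField F ι₁ Θ hψ hT k.2,
    fun _ => rfl⟩

/-- **(C6b*) AT THE LIU PIN — the (hCM) binder of the pinned junction is a theorem.**  `F` a Galois CM field, `ι₁ : F → ℂ`,
`Φ, Θ` CM types of `F` inverse through `ι₁` (`Θ = Φ^{*ι₁}`), `μ = ψ` conjugate symplectic with CM type `Θ`; `M_μ` is a CM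
number field (instances `IsConjugateSymplectic.numberField_muAlgValueField` ∕ `.isCMField_muAlgValueField`), and for the
inclusion `e_μ : K* → M_μ` of the reflex field and the induced type `Ψ̃_μ = (Θ*)^{M_μ}` — the type of Liu's `A_μ ⊗_{E,ι₁} ℂ`
over `M_μ` ([Liu2021] Def. 4.5 (2) + Def. 4.3 (2)) — every non-zero `u : X ⟶ A_{(M_μ, Ψ̃_μ)}` into the tree's own CM abelian
variety of that type yields a non-zero `X ⟶ A_{(F,Φ)}` (binder-1 `exists_hom_cmAV_ne_zero_of_reach_cmCode_reflex`: Shimura §6.2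
Thm. 3 + §6.1 Cor. over Riemann's theorem, and the Galois identity "the reflex pair of `Φ^{*ι₁}` induces `Φ`").  HC_CM is NOT
proved: the Shimura–Albanese side (hReach) of the object match is untouched.
[cite: Liu2021, §4.1 (TeX ll. 1922–1928), Def. 4.3 (2) and Def. 4.5 (2)] [cite: Shimura1998, §6.2 Theorem 3 and §8.3 Prop. 28] -/
theorem exists_liuPin_reach (h₃ : CMAbelianVarietyRealised) (F : CMField) [IsGalois ℚ F] (ι₁ : F →+* ℂ) {Φ Θ : CMType F}
    (hΘ : ∀ g : F ≃ₐ[ℚ] F, ι₁.comp (g : F →+* F) ∈ Θ.1 ↔ ι₁.comp (g.symm : F →+* F) ∈ Φ.1)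
    {ψ : IdeleClassGroup F →ₜ* Circle} (hψ : IsConjugateSymplectic F ψ) (hT : HasCMType F ψ Θ) :
    haveI := hψ.numberField_muAlgValueField
    haveI := hψ.isCMField_muAlgValueField
    ∃ e : reflexField ℚ F (algValuedIn ι₁ Θ.1) →+* muAlgValueField F ψ,
      (∀ k : reflexField ℚ F (algValuedIn ι₁ Θ.1), ((e k : muAlgValueField F ψ) : ℂ) = ι₁ k) ∧
      ∀ (X : AbelianVariety ℂ)
        (u : X ⟶ (cmRealisation h₃ (cmCode (CMField.mk (muAlgValueField F ψ))
          (inducedCMType e (reflexCMType ι₁ Θ (AlgHom.id ℚ F))))).AV), u ≠ 0 →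
        ∃ v : X ⟶ (cmRealisation h₃ (cmCode F Φ)).AV, v ≠ 0 := by
  haveI := hψ.numberField_muAlgValueField
  haveI := hψ.isCMField_muAlgValueField
  obtain ⟨e, he⟩ := exists_ringHom_reflexField_muAlgValueField F ι₁ Θ hψ hT
  exact ⟨e, he, fun X u hu =>
    exists_hom_cmAV_ne_zero_of_reach_cmCode_reflex h₃ F ι₁ hΘ (CMField.mk (muAlgValueField F ψ)) e hu⟩

/-- **The (hCM) witness at the Liu pin, literally in the shape of [Liu2021] Def. 4.5 (2)** (cells' pinned junction v2 binder
`hCM : ∃ M e ιB θB, IsCMTypeRealisation (inducedCMType e (reflexCMType ι₁ Φ_μ id)) (Aμ …) ιB θB`): with `M := ⟨M_μ⟩` and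
`Aμ := A_{(M_μ, Ψ̃_μ)} = (cmRealisation h₃ (cmCode ⟨M_μ⟩ Ψ̃_μ)).AV`, `Ψ̃_μ = inducedCMType e_μ (reflexCMType ι₁ Θ id)`, the tree's chosen
realisation realises `Ψ̃_μ` on `H¹` (`isCMTypeRealisation_cmCode_read`) — so (hCM) HOLDS at this pin, by name, for `Θ = Φ_μ`
(`hT`; e.g. `hψ.hasCMType_cmType`). [cite: Liu2021, Def. 4.5 (2) and Def. 4.3 (2)] [cite: Shimura1998, §5.2 and §6.2 Theorem 3] -/
theorem exists_liuPin_isCMTypeRealisation (h₃ : CMAbelianVarietyRealised) (F : CMField) [IsGalois ℚ F] (ι₁ : F →+* ℂ)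
    (Θ : CMType F) {ψ : IdeleClassGroup F →ₜ* Circle} (hψ : IsConjugateSymplectic F ψ) (hT : HasCMType F ψ Θ) :
    haveI := hψ.numberField_muAlgValueField
    haveI := hψ.isCMField_muAlgValueField
    ∃ e : reflexField ℚ F (algValuedIn ι₁ Θ.1) →+* muAlgValueField F ψ,
      (∀ k : reflexField ℚ F (algValuedIn ι₁ Θ.1), ((e k : muAlgValueField F ψ) : ℂ) = ι₁ k) ∧
      ∃ (ιB : 𝓞 (muAlgValueField F ψ) →+*
            End (cmRealisation h₃ (cmCode (CMField.mk (muAlgValueField F ψ))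
              (inducedCMType e (reflexCMType ι₁ Θ (AlgHom.id ℚ F))))).AV)
        (θB : muAlgValueField F ψ →+*
            Module.End ℂ (complexBetti (cmRealisation h₃ (cmCode (CMField.mk (muAlgValueField F ψ))
              (inducedCMType e (reflexCMType ι₁ Θ (AlgHom.id ℚ F))))).AV.X 1)),
        IsCMTypeRealisation (inducedCMType e (reflexCMType ι₁ Θ (AlgHom.id ℚ F)))
          (cmRealisation h₃ (cmCode (CMField.mk (muAlgValueField F ψ))
            (inducedCMType e (reflexCMType ι₁ Θ (AlgHom.id ℚ F))))).AV ιB θB := by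
  haveI := hψ.numberField_muAlgValueField
  haveI := hψ.isCMField_muAlgValueField
  obtain ⟨e, he⟩ := exists_ringHom_reflexField_muAlgValueField F ι₁ Θ hψ hT
  exact ⟨e, he, _, _, isCMTypeRealisation_cmCode_read h₃ (CMField.mk (muAlgValueField F ψ))
    (inducedCMType e (reflexCMType ι₁ Θ (AlgHom.id ℚ F)))⟩

/-- **Existence form over the type alone**: for every Galois CM `F`, `ι₁`, and inverse CM types `Φ, Θ = Φ^{*ι₁}` there IS a
conjugate symplectic `μ` OF WEIGHT ONE with `Φ_μ = Θ` (tree `exists_isConjugateSymplectic_hasCMType`), and at its Liu pin the CM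
side of the object match holds as in `exists_liuPin_reach`. [cite: Liu2021, Def. 4.3, Prop. 4.6 (1) and Def. 4.5 (2)] -/
theorem exists_weightOne_liuPin_reach (h₃ : CMAbelianVarietyRealised) (F : CMField) [IsGalois ℚ F] (ι₁ : F →+* ℂ)
    {Φ Θ : CMType F} (hΘ : ∀ g : F ≃ₐ[ℚ] F, ι₁.comp (g : F →+* F) ∈ Θ.1 ↔ ι₁.comp (g.symm : F →+* F) ∈ Φ.1) :
    ∃ (ψ : IdeleClassGroup F →ₜ* Circle) (hψ : IsConjugateSymplectic F ψ), HasWeight F ψ 1 ∧ HasCMType F ψ Θ ∧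
      (haveI := hψ.numberField_muAlgValueField
       haveI := hψ.isCMField_muAlgValueField
       ∃ e : reflexField ℚ F (algValuedIn ι₁ Θ.1) →+* muAlgValueField F ψ,
        (∀ k : reflexField ℚ F (algValuedIn ι₁ Θ.1), ((e k : muAlgValueField F ψ) : ℂ) = ι₁ k) ∧
        ∀ (X : AbelianVariety ℂ)
          (u : X ⟶ (cmRealisation h₃ (cmCode (CMField.mk (muAlgValueField F ψ))
            (inducedCMType e (reflexCMType ι₁ Θ (AlgHom.id ℚ F))))).AV), u ≠ 0 →
          ∃ v : X ⟶ (cmRealisation h₃ (cmCode F Φ)).AV, v ≠ 0) := by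
  obtain ⟨ψ, hψ, hw, hT⟩ := exists_isConjugateSymplectic_hasCMType (L := F) Θ
  exact ⟨ψ, hψ, hw, hT, exists_liuPin_reach h₃ F ι₁ hΘ hψ hT⟩

end Summit.HodgeConjecture.CorCM.Model

end
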